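import Summits.BirchSwinnertonDyer.BirchSwinnertonDyer.Theorems.KolyvaginRoadThreeZhangSupplyOfPoitouTate
import Summits.BirchSwinnertonDyer.BirchSwinnertonDyer.Theorems.KolyvaginRoadThreeMethod2TriangulationOfSupply
import Summits.BirchSwinnertonDyer.BirchSwinnertonDyer.Theorems.KolyvaginRoadThreeMethod2EngineOfTriangulation
import Summits.BirchSwinnertonDyer.Rank1Residual.X11b.Three.HeegnerDiscriminantBound
import Summits.BirchSwinnertonDyer.Rank1Residual.X11b.Three.StepLAtThree
import Literature.NumberTheory.EllipticCurves.HeegnerHypothesisKroneckerProofs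
import Literature.NumberTheory.NumberFields.CongruenceSubgroupTorsionFree
import HarnessLib

/-!
# Route `KolyvaginRoadThree`, deciding crux `ZhangSharpFrameAtThreeHL` (item stmt-BirchSwinnertonDyer-19574):
# S2-ENGINE from the Poitou–Tate fact and the local line-rigidity at Kolyvagin primes
# (cell `bsd-stepL`, ACCEL seat `bsd-stepL-koly3b` g6; `--supports stmt-BirchSwinnertonDyer-19574`, helper; part XXVI of the
# `KolyvaginRoadThreeZhangSupply*` series)

HONEST FRAMING. Composition only; 0 definitions, 0 named facts, 0 `sorry`; closes nothing (T7) — the crux is NOT claimed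
and the stub is NOT booked: the closed-form theorems below are CONDITIONAL on the named Poitou–Tate fact
`poitouTate_selmerStructure_duality` (hypothesis `hPT`) and on ONE local rigidity statement at Kolyvagin primes
(hypothesis `hRig`, resp. its both-ramified case `hRam` — zhang3-p1 g10's `KolyLocal.sub_zsmul_mem_torsionLocalKer_of_isotropic`,
`Theorems/KolyvaginRoadThreeMethod2KolyvaginIsoBound(Local)`, plugs into `hRig`; see part XXVII). PARTITION: O2@3 (B10) × A1 × crux 19574 ×
stub S2-ENGINE `stub_inductionOfLevelSystemsAtThree` — proves-glue.

WHAT. §1: places above the unipotent-admissible ∕ Kolyvagin primes exist. §2: at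
one frame instance, Zhang's Lemma 8.4 triangulation at every good non-empty level carrying a non-zero class of a level
Kolyvagin system follows from `Method2.triangulation_of_supply` (zhang3-p1) fed with part XXV's
`hSupply_of_poitouTate` ∕ `hSupply_of_poitouTate_of_ramifiedCase` (places `plK` above the Kolyvagin primes as parameters). §3: the registered S2-ENGINE stub
`Method2.stub_inductionOfLevelSystemsAtThree` (skeleton v3, text VERBATIM as the conclusion) from the OWNER's
`Method2EngineOfTriangulation.inductionOfLevelSystems_of_triangulation` (koly g14) and §2, the frame binders supplying
`d_K < −4` (`Three.discr_lt_neg_four_of_isCoprime_of_dvd_sq_sub`, Heegner coprimality, `3 ∣ N`). So, in the kernel: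
S2-ENGINE ⟸ {PT fact, local rigidity at Kolyvagin primes}. [cite: WZhang2014, §9 proof of Thm. 9.1, Lemma 8.2, Lemma 8.4]
[cite: MilneADT2006, Ch. I, Thm. 4.10] [cite: GrossLMS1991, Prop. 8.1–8.2, 9.6]
-/

noncomputable section

open scoped Classical Pointwise

namespace Summit.BirchSwinnertonDyer.Rank1Residual.X11b.Three.Koly.ZhangSupply

open CategoryTheory WeierstrassCurve Field Function NumberField IsDedekindDomain
open Literature.NumberTheory.EllipticCurves Literature.NumberTheory.EllipticCurves.ModularForms
  Literature.NumberTheory.GaloisRepresentations Module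
open Literature.NumberTheory.GaloisRepresentations.DiscreteGaloisModule (mu MuCarrier)
open Literature.NumberTheory.GaloisCohomology
open Summit.BirchSwinnertonDyer.Rank1Residual.X11b.Three.Koly.Method2
open Summit.BirchSwinnertonDyer.Rank1Residual.X11b.Three.Koly.Method2.KolyLocal
open Summit.BirchSwinnertonDyer.Rank1Residual.GaloisImage
open scoped ContRepresentation

-- Cup products need `LocallyCompactSpace Γ`; `E[n]` finite: local instances (as in the tree's cup-product files).
attribute [local instance] absoluteGaloisGroup_compactSpace
attribute [local instance] finite_geomTorsion_of_neZero

variable (W : WeierstrassCurve ℚ) (K : Type) [Field K] [NumberField K] [W.IsElliptic] [W.IsGloballyMinimal]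

/-! ## §1 Places above the unipotent-admissible primes -/

omit [W.IsElliptic] in
/-- A choice of a finite place of `K` above every unipotent-admissible prime `q` (a prime of `ℤ` lies in some prime
of `𝓞 K`). [folklore] -/
theorem exists_placesAbove_uAdmissible :
    ∃ plU : {q // IsUAdmissiblePrime W K q} → HeightOneSpectrum (𝓞 K), ∀ q, ((q : ℕ) : 𝓞 K) ∈ (plU q).asIdeal :=
  ⟨fun q ↦ (Literature.NumberTheory.NumberFields.RingOfIntegers.exists_heightOneSpectrum_natCast_mem K q.2.1).choose,
    fun q ↦ (Literature.NumberTheory.NumberFields.RingOfIntegers.exists_heightOneSpectrum_natCast_mem K q.2.1).choose_spec⟩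

omit [W.IsElliptic] in
/-- A choice of a finite place of `K` above every Kolyvagin prime `ℓ` (for Zhang's inert `ℓ` this is `λ = ℓ𝓞_K`, but any
prime above `ℓ` will do here). [folklore] -/
theorem exists_placesAbove_kolyvagin :
    ∃ plK : {ℓ // Zhang2014.IsKolyvaginPrime (W.conductorNorm ℤ) W K 3 ℓ} → HeightOneSpectrum (𝓞 K),
      ∀ ℓ, ((ℓ : ℕ) : 𝓞 K) ∈ (plK ℓ).asIdeal :=
  ⟨fun ℓ ↦ (Literature.NumberTheory.NumberFields.RingOfIntegers.exists_heightOneSpectrum_natCast_mem K ℓ.2.1).choose,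
    fun ℓ ↦ (Literature.NumberTheory.NumberFields.RingOfIntegers.exists_heightOneSpectrum_natCast_mem K ℓ.2.1).choose_spec⟩

/-! ## §2 The triangulation at one frame instance, from the PT fact and the local rigidity -/

/-- **Zhang's Lemma 8.4 triangulation at every good non-empty level, from the Poitou–Tate fact and (IsoBound) in
cup-product currency.** At a frame instance (`K` imaginary quadratic with `d_K < −4`, `E` multiplicative at `3` with
surjective mod-`3` image, complex conjugation `c ≠ 1`), for a level Kolyvagin system `S` and a good non-empty level `n`
carrying a non-zero class: `Method2.triangulation_of_supply` with places `plK` above the Kolyvagin primes, any places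
above the unipotent-admissible primes (§1), and (Supply) := part XXV `hSupply_of_poitouTate`. Inputs left: the PT fact `hPT`
and the local rigidity `hboundCup` at the places `plK`. [cite: WZhang2014, Lemma 8.2, Lemma 8.4 (1)+(3)]
[cite: MilneADT2006, Ch. I, Thm. 4.10] -/
theorem triangulation_of_poitouTate [NeZero (W.conductorNorm ℤ)] [Module (ZMod 3) (V3 W K)]
    (Dt : ModularParametrizationData W (W.conductorNorm ℤ)) (β : ℤ) (ι : K →+* ℂ) (c : K ≃ₐ[ℚ] K)
    (hK : IsImaginaryQuadratic K) (hmult : W.HasMultiplicativeReductionAtPrime 3)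
    (hsurj : W.HasSurjectiveModNGaloisRep 3) (hd : NumberField.discr K < -4) (hc : c ≠ 1)
    (hPT : poitouTate_selmerStructure_duality K) (S : LevelKolyvaginSystem W K Dt β ι c)
    (plK : {ℓ // Zhang2014.IsKolyvaginPrime (W.conductorNorm ℤ) W K 3 ℓ} → HeightOneSpectrum (𝓞 K))
    (hplK : ∀ ℓ, ((ℓ : ℕ) : 𝓞 K) ∈ (plK ℓ).asIdeal)
    (hboundCup : ∀ (e : geomTorsion (W.baseChange K) ((3 ^ 1 : ℕ) : ℤ) → geomTorsion (W.baseChange K) ((3 ^ 1 : ℕ) : ℤ) →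
          AlgebraicClosure K)
        (hμ : ∀ P Q, e P Q ^ (3 ^ 1) = 1) (hadd₁ : ∀ P₁ P₂ Q, e (P₁ + P₂) Q = e P₁ Q * e P₂ Q)
        (hadd₂ : ∀ P Q₁ Q₂, e P (Q₁ + Q₂) = e P Q₁ * e P Q₂) (_halt : ∀ Q, e Q Q = 1)
        (_hnondeg : ∀ Q, (∀ P, e P Q = 1) → Q = 0)
        (hgal : ∀ (σ : absoluteGaloisGroup K) (P Q : geomTorsion (W.baseChange K) ((3 ^ 1 : ℕ) : ℤ)),
          σ • e P Q = e (σ • P) (σ • Q))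
        (ℓ : {ℓ // Zhang2014.IsKolyvaginPrime (W.conductorNorm ℤ) W K 3 ℓ}) (s : Bool) (x y : V3 W K),
      conjAct W c ((3 ^ 1 : ℕ) : ℤ) x = sgn s • x → conjAct W c ((3 ^ 1 : ℕ) : ℤ) y = sgn s • y →
      (weilContPairingLocal (W.baseChange K) (3 ^ 1) e hμ hadd₁ hadd₂ hgal (Sum.inr (plK ℓ))).cupProduct
        (galoisCohomology.localization ((W.baseChange K).torsionGaloisModule ((3 ^ 1 : ℕ) : ℤ)) (Sum.inr (plK ℓ)) 1 x)
        (galoisCohomology.localization ((W.baseChange K).torsionGaloisModule ((3 ^ 1 : ℕ) : ℤ)) (Sum.inr (plK ℓ)) 1 x)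
          = 0 →
      (weilContPairingLocal (W.baseChange K) (3 ^ 1) e hμ hadd₁ hadd₂ hgal (Sum.inr (plK ℓ))).cupProduct
        (galoisCohomology.localization ((W.baseChange K).torsionGaloisModule ((3 ^ 1 : ℕ) : ℤ)) (Sum.inr (plK ℓ)) 1 x)
        (galoisCohomology.localization ((W.baseChange K).torsionGaloisModule ((3 ^ 1 : ℕ) : ℤ)) (Sum.inr (plK ℓ)) 1 y)
          = 0 →
      (weilContPairingLocal (W.baseChange K) (3 ^ 1) e hμ hadd₁ hadd₂ hgal (Sum.inr (plK ℓ))).cupProduct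
        (galoisCohomology.localization ((W.baseChange K).torsionGaloisModule ((3 ^ 1 : ℕ) : ℤ)) (Sum.inr (plK ℓ)) 1 y)
        (galoisCohomology.localization ((W.baseChange K).torsionGaloisModule ((3 ^ 1 : ℕ) : ℤ)) (Sum.inr (plK ℓ)) 1 x)
          = 0 →
      (weilContPairingLocal (W.baseChange K) (3 ^ 1) e hμ hadd₁ hadd₂ hgal (Sum.inr (plK ℓ))).cupProduct
        (galoisCohomology.localization ((W.baseChange K).torsionGaloisModule ((3 ^ 1 : ℕ) : ℤ)) (Sum.inr (plK ℓ)) 1 y)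
        (galoisCohomology.localization ((W.baseChange K).torsionGaloisModule ((3 ^ 1 : ℕ) : ℤ)) (Sum.inr (plK ℓ)) 1 y)
          = 0 →
      x ∉ (W.baseChange K).torsionLocalKer ((plK ℓ).adicCompletion K) ((3 ^ 1 : ℕ) : ℤ) →
      ∃ a : ℤ, y - a • x ∈ (W.baseChange K).torsionLocalKer ((plK ℓ).adicCompletion K) ((3 ^ 1 : ℕ) : ℤ))
    (n : Finset {q // IsUAdmissiblePrime W K q}) (hg : GoodLevel W K n) (hn : n.Nonempty) (hne : ∃ m, S.κ m n ≠ 0) :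
    ∃ (s : Bool) (d : ℕ), finrank (ZMod 3) (SelQ W K c n s) = d + 1 ∧
      SelQ W K c n s = SelRelQ W K c n (baseLocusQ W K S.κ n) s ∧
      FiniteDimensional (ZMod 3) (SelRelQ W K c n (baseLocusQ W K S.κ n) (!s)) ∧
      finrank (ZMod 3) (SelRelQ W K c n (baseLocusQ W K S.κ n) (!s)) ≤ d := by
  obtain ⟨plU, hplU⟩ := exists_placesAbove_uAdmissible W K
  exact triangulation_of_supply W K Dt β ι c hK hmult hsurj hc S plK plU hplK hplU n hg hn hne
    (hSupply_of_poitouTate W K ι c hK hd hc hPT plK hplK hboundCup n hg hn)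

/-- **The same, modulo the BOTH-RAMIFIED case only** (`hram` of part XXIV at the places `plK`, via part XXV's
`hSupply_of_poitouTate_of_ramifiedCase`). [cite: WZhang2014, Lemma 8.2, Lemma 8.4 (1)+(3)] [cite: GrossLMS1991, Prop. 8.1–8.2] -/
theorem triangulation_of_poitouTate_of_ramifiedCase [NeZero (W.conductorNorm ℤ)] [Module (ZMod 3) (V3 W K)]
    (Dt : ModularParametrizationData W (W.conductorNorm ℤ)) (β : ℤ) (ι : K →+* ℂ) (c : K ≃ₐ[ℚ] K)
    (hK : IsImaginaryQuadratic K) (hmult : W.HasMultiplicativeReductionAtPrime 3)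
    (hsurj : W.HasSurjectiveModNGaloisRep 3) (hd : NumberField.discr K < -4) (hc : c ≠ 1)
    (hPT : poitouTate_selmerStructure_duality K) (S : LevelKolyvaginSystem W K Dt β ι c)
    (plK : {ℓ // Zhang2014.IsKolyvaginPrime (W.conductorNorm ℤ) W K 3 ℓ} → HeightOneSpectrum (𝓞 K))
    (hplK : ∀ ℓ, ((ℓ : ℕ) : 𝓞 K) ∈ (plK ℓ).asIdeal)
    (hram : ∀ (e : geomTorsion (W.baseChange K) ((3 ^ 1 : ℕ) : ℤ) → geomTorsion (W.baseChange K) ((3 ^ 1 : ℕ) : ℤ) →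
          AlgebraicClosure K)
        (hμ : ∀ P Q, e P Q ^ (3 ^ 1) = 1) (hadd₁ : ∀ P₁ P₂ Q, e (P₁ + P₂) Q = e P₁ Q * e P₂ Q)
        (hadd₂ : ∀ P Q₁ Q₂, e P (Q₁ + Q₂) = e P Q₁ * e P Q₂) (_halt : ∀ Q, e Q Q = 1)
        (_hnondeg : ∀ Q, (∀ P, e P Q = 1) → Q = 0)
        (hgal : ∀ (σ : absoluteGaloisGroup K) (P Q : geomTorsion (W.baseChange K) ((3 ^ 1 : ℕ) : ℤ)),
          σ • e P Q = e (σ • P) (σ • Q))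
        (ℓ : {ℓ // Zhang2014.IsKolyvaginPrime (W.conductorNorm ℤ) W K 3 ℓ}) (s : Bool) (x y : V3 W K),
      conjAct W c ((3 ^ 1 : ℕ) : ℤ) x = sgn s • x → conjAct W c ((3 ^ 1 : ℕ) : ℤ) y = sgn s • y →
      x ∉ selmerLocalKer (W.baseChange K) ((plK ℓ).adicCompletion K) ((3 ^ 1 : ℕ) : ℤ) →
      y ∉ selmerLocalKer (W.baseChange K) ((plK ℓ).adicCompletion K) ((3 ^ 1 : ℕ) : ℤ) →
      (weilContPairingLocal (W.baseChange K) (3 ^ 1) e hμ hadd₁ hadd₂ hgal (Sum.inr (plK ℓ))).cupProduct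
        (galoisCohomology.localization ((W.baseChange K).torsionGaloisModule ((3 ^ 1 : ℕ) : ℤ)) (Sum.inr (plK ℓ)) 1 x)
        (galoisCohomology.localization ((W.baseChange K).torsionGaloisModule ((3 ^ 1 : ℕ) : ℤ)) (Sum.inr (plK ℓ)) 1 x)
          = 0 →
      (weilContPairingLocal (W.baseChange K) (3 ^ 1) e hμ hadd₁ hadd₂ hgal (Sum.inr (plK ℓ))).cupProduct
        (galoisCohomology.localization ((W.baseChange K).torsionGaloisModule ((3 ^ 1 : ℕ) : ℤ)) (Sum.inr (plK ℓ)) 1 x)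
        (galoisCohomology.localization ((W.baseChange K).torsionGaloisModule ((3 ^ 1 : ℕ) : ℤ)) (Sum.inr (plK ℓ)) 1 y)
          = 0 →
      (weilContPairingLocal (W.baseChange K) (3 ^ 1) e hμ hadd₁ hadd₂ hgal (Sum.inr (plK ℓ))).cupProduct
        (galoisCohomology.localization ((W.baseChange K).torsionGaloisModule ((3 ^ 1 : ℕ) : ℤ)) (Sum.inr (plK ℓ)) 1 y)
        (galoisCohomology.localization ((W.baseChange K).torsionGaloisModule ((3 ^ 1 : ℕ) : ℤ)) (Sum.inr (plK ℓ)) 1 y)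
          = 0 →
      x ∉ (W.baseChange K).torsionLocalKer ((plK ℓ).adicCompletion K) ((3 ^ 1 : ℕ) : ℤ) →
      ∃ a : ℤ, y - a • x ∈ (W.baseChange K).torsionLocalKer ((plK ℓ).adicCompletion K) ((3 ^ 1 : ℕ) : ℤ))
    (n : Finset {q // IsUAdmissiblePrime W K q}) (hg : GoodLevel W K n) (hn : n.Nonempty) (hne : ∃ m, S.κ m n ≠ 0) :
    ∃ (s : Bool) (d : ℕ), finrank (ZMod 3) (SelQ W K c n s) = d + 1 ∧
      SelQ W K c n s = SelRelQ W K c n (baseLocusQ W K S.κ n) s ∧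
      FiniteDimensional (ZMod 3) (SelRelQ W K c n (baseLocusQ W K S.κ n) (!s)) ∧
      finrank (ZMod 3) (SelRelQ W K c n (baseLocusQ W K S.κ n) (!s)) ≤ d := by
  obtain ⟨plU, hplU⟩ := exists_placesAbove_uAdmissible W K
  exact triangulation_of_supply W K Dt β ι c hK hmult hsurj hc S plK plU hplK hplU n hg hn hne
    (hSupply_of_poitouTate_of_ramifiedCase W K ι c hK hd hc hsurj hPT plK hplK hram n hg hn)

/-! ## §3 The S2-ENGINE stub, closed form, from the PT fact and the local rigidity -/

omit [W.IsElliptic] [W.IsGloballyMinimal] in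
/-- `d_K < −4` at a frame: `K` imaginary quadratic, Heegner hypothesis for `N` (so `(N, d_K) = 1`), `3 ∣ N`
(multiplicative reduction at `3`), `4N ∣ β² − d_K`. [cite: GrossLMS1991, §1] -/
theorem discr_lt_neg_four_of_frame [W.IsElliptic] (hX : Summit.BirchSwinnertonDyer.Rank1Residual.ClassX11b W 3)
    (hK : IsImaginaryQuadratic K) (hH : SatisfiesHeegnerHypothesis (W.conductorNorm ℤ) K) {β : ℤ}
    (hβ : (4 * (W.conductorNorm ℤ : ℤ)) ∣ β ^ 2 - NumberField.discr K) : NumberField.discr K < -4 := by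
  have hND : IsCoprime (W.conductorNorm ℤ : ℤ) (NumberField.discr K) := by
    have h := Literature.SatisfiesHeegnerHypothesis.coprime_discr hK.1 hH
    refine Int.isCoprime_iff_gcd_eq_one.mpr ?_
    rw [Int.gcd_eq_natAbs, Int.natAbs_natCast]
    exact h
  exact discr_lt_neg_four_of_isCoprime_of_dvd_sq_sub hK hND (dvd_conductorNorm_of_classX11b hX) hβ

/-- **S2-ENGINE `Method2.stub_inductionOfLevelSystemsAtThree` (skeleton v3 of crux 19574, text VERBATIM as the conclusion)
FROM the named Poitou–Tate fact and the local line-rigidity at Kolyvagin primes (cup-product currency).** Hypotheses: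
`hPT` — `poitouTate_selmerStructure_duality K` for imaginary quadratic `K` (named fact, Milne ADT I.4.10); `hRig` — at every
Kolyvagin prime `ℓ` of a curve with surjective mod-`3` image over an imaginary quadratic `K`, for every Weil-type pairing `e`
on `E[3]`, two `c`-eigenclasses of `H¹(K, E[3])` of the same sign whose `λ`-localisations are mutually and self isotropic for
the local Weil cup product, the first with `loc_λ ≠ 0`, have proportional localisations (W. Zhang Lemma 8.4 (1) local
input; Gross Prop. 8.1–8.2 ∕ 9.6). Proof: the OWNER's `inductionOfLevelSystems_of_triangulation` (koly g14) ∘ §2.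
CONDITIONAL on `hPT`, `hRig`; nothing is booked. [cite: WZhang2014, §9 proof of Thm. 9.1, Lemma 8.2, Lemma 8.4]
[cite: MilneADT2006, Ch. I, Thm. 4.10] [cite: GrossLMS1991, Prop. 8.1–8.2, 9.6] -/
theorem stub_inductionOfLevelSystemsAtThree_of_poitouTate_of_rigidity
    (hPT : ∀ (K : Type) [Field K] [NumberField K], IsImaginaryQuadratic K → poitouTate_selmerStructure_duality K)
    (hRig : ∀ (W : WeierstrassCurve ℚ) [W.IsElliptic] [W.IsGloballyMinimal] (K : Type) [Field K] [NumberField K],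
      IsImaginaryQuadratic K → W.HasSurjectiveModNGaloisRep 3 → ∀ (c : K ≃ₐ[ℚ] K), c ≠ 1 →
      ∀ (e : geomTorsion (W.baseChange K) ((3 ^ 1 : ℕ) : ℤ) → geomTorsion (W.baseChange K) ((3 ^ 1 : ℕ) : ℤ) →
          AlgebraicClosure K)
        (hμ : ∀ P Q, e P Q ^ (3 ^ 1) = 1) (hadd₁ : ∀ P₁ P₂ Q, e (P₁ + P₂) Q = e P₁ Q * e P₂ Q)
        (hadd₂ : ∀ P Q₁ Q₂, e P (Q₁ + Q₂) = e P Q₁ * e P Q₂) (_halt : ∀ Q, e Q Q = 1)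
        (_hnondeg : ∀ Q, (∀ P, e P Q = 1) → Q = 0)
        (hgal : ∀ (σ : absoluteGaloisGroup K) (P Q : geomTorsion (W.baseChange K) ((3 ^ 1 : ℕ) : ℤ)),
          σ • e P Q = e (σ • P) (σ • Q))
        {ℓ : ℕ} (hℓ : Zhang2014.IsKolyvaginPrime (W.conductorNorm ℤ) W K 3 ℓ) (v : HeightOneSpectrum (𝓞 K))
        (_hv : (ℓ : 𝓞 K) ∈ v.asIdeal) (s : Bool) (x y : V3 W K),
      conjAct W c ((3 ^ 1 : ℕ) : ℤ) x = sgn s • x → conjAct W c ((3 ^ 1 : ℕ) : ℤ) y = sgn s • y →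
      (weilContPairingLocal (W.baseChange K) (3 ^ 1) e hμ hadd₁ hadd₂ hgal (Sum.inr v)).cupProduct
        (galoisCohomology.localization ((W.baseChange K).torsionGaloisModule ((3 ^ 1 : ℕ) : ℤ)) (Sum.inr v) 1 x)
        (galoisCohomology.localization ((W.baseChange K).torsionGaloisModule ((3 ^ 1 : ℕ) : ℤ)) (Sum.inr v) 1 x) = 0 →
      (weilContPairingLocal (W.baseChange K) (3 ^ 1) e hμ hadd₁ hadd₂ hgal (Sum.inr v)).cupProduct
        (galoisCohomology.localization ((W.baseChange K).torsionGaloisModule ((3 ^ 1 : ℕ) : ℤ)) (Sum.inr v) 1 x)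
        (galoisCohomology.localization ((W.baseChange K).torsionGaloisModule ((3 ^ 1 : ℕ) : ℤ)) (Sum.inr v) 1 y) = 0 →
      (weilContPairingLocal (W.baseChange K) (3 ^ 1) e hμ hadd₁ hadd₂ hgal (Sum.inr v)).cupProduct
        (galoisCohomology.localization ((W.baseChange K).torsionGaloisModule ((3 ^ 1 : ℕ) : ℤ)) (Sum.inr v) 1 y)
        (galoisCohomology.localization ((W.baseChange K).torsionGaloisModule ((3 ^ 1 : ℕ) : ℤ)) (Sum.inr v) 1 x) = 0 →
      (weilContPairingLocal (W.baseChange K) (3 ^ 1) e hμ hadd₁ hadd₂ hgal (Sum.inr v)).cupProduct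
        (galoisCohomology.localization ((W.baseChange K).torsionGaloisModule ((3 ^ 1 : ℕ) : ℤ)) (Sum.inr v) 1 y)
        (galoisCohomology.localization ((W.baseChange K).torsionGaloisModule ((3 ^ 1 : ℕ) : ℤ)) (Sum.inr v) 1 y) = 0 →
      x ∉ (W.baseChange K).torsionLocalKer (v.adicCompletion K) ((3 ^ 1 : ℕ) : ℤ) →
      ∃ a : ℤ, y - a • x ∈ (W.baseChange K).torsionLocalKer (v.adicCompletion K) ((3 ^ 1 : ℕ) : ℤ)) :
    ∀ (W : WeierstrassCurve ℚ) [W.IsElliptic] [W.IsGloballyMinimal] [NeZero (W.conductorNorm ℤ)] (K : Type)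
      [Field K] [NumberField K] (Dt : ModularParametrizationData W (W.conductorNorm ℤ)) (β : ℤ) (ι : K →+* ℂ),
      Summit.BirchSwinnertonDyer.Rank1Residual.ClassX11b W 3 → W.HasMultiplicativeReductionAtPrime 3 →
      Rank1Residual.Surj W 3 → Rank1Residual.Ram W 3 → ¬ 3 ∣ W.tamagawaProduct → IsImaginaryQuadratic K →
      Odd (NumberField.discr K) → SatisfiesHeegnerHypothesis (W.conductorNorm ℤ) K →
      (W.quadraticTwist (NumberField.discr K : ℚ)).entireLFunction 1 ≠ 0 → NumberField.discr K ≠ -3 →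
      (4 * (W.conductorNorm ℤ : ℤ)) ∣ β ^ 2 - NumberField.discr K → ¬ (3 : ℤ) ∣ Dt.c →
      ∀ (c : K ≃ₐ[ℚ] K), c ≠ 1 → ∀ [Module (ZMod 3) (V3 W K)],
      LevelKolyvaginSystem W K Dt β ι c →
      -- (A1) at the frame (stub A's body, verbatim) as HYPOTHESIS
      (∀ (n : Finset {q // IsUAdmissiblePrime W K q}) (μ : Bool) (x : V3 W K),
        GoodLevel W K n → x ∈ SelQ W K c n μ → x ≠ 0 →
        ∃ q : {q // IsUAdmissiblePrime W K q}, q ∉ n ∧ GoodLevel W K (insert q n) ∧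
          x ∉ SelQ W K c (insert q n) μ ∧
          SelQ W K c (insert q n) μ ≤ SelQ W K c n μ ∧
          finrank (ZMod 3) (SelQ W K c (insert q n) μ) + 1 = finrank (ZMod 3) (SelQ W K c n μ) ∧
          SelQ W K c (insert q n) (!μ) = SelQ W K c n (!μ)) →
      Odd (finrank (ZMod 3)
        (AddSubgroup.toZModSubmodule 3 (selmerGroup (W.baseChange K) ((3 ^ 1 : ℕ) : ℤ)))) →
      3 ≤ finrank (ZMod 3)
        (AddSubgroup.toZModSubmodule 3 (selmerGroup (W.baseChange K) ((3 ^ 1 : ℕ) : ℤ))) →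
      ∃ (n : ℕ) (d : KolyvaginHeegnerData Dt β ι n),
        KolyvaginDescent.KolSupp (Zhang2014.IsKolyvaginPrime (W.conductorNorm ℤ) W K 3) n ∧
          d.kolyvaginClass Nat.prime_three 1 ≠ 0 := by
  refine Method2EngineOfTriangulation.inductionOfLevelSystems_of_triangulation ?_
  intro W _ _ _ K _ _ Dt β ι hX hmult hsurj _hRam _htam hK _hodd hH _hLt _h3 hβ _hc c hc1 _ S n hg hn _hev hne
  have hd : NumberField.discr K < -4 := discr_lt_neg_four_of_frame W K hX hK hH hβ
  obtain ⟨plK, hplK⟩ := exists_placesAbove_kolyvagin W K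
  exact triangulation_of_poitouTate W K Dt β ι c hK hmult hsurj hd hc1 (hPT K hK) S plK hplK
    (fun e hμ hadd₁ hadd₂ halt hnondeg hgal ℓ s x y hxs hys h11 h12 h21 h22 hx0 ↦
      hRig W K hK hsurj c hc1 e hμ hadd₁ hadd₂ halt hnondeg hgal ℓ.2 (plK ℓ) (hplK ℓ) s x y hxs hys h11 h12
        h21 h22 hx0)
    n hg hn hne

/-- **S2-ENGINE from the PT fact modulo the BOTH-RAMIFIED rigidity case only** (`hRam`: the statement of `hRig` restricted
to pairs of classes that are NOT Selmer at `λ` and without the `(y, x)` isotropy clause — the hypothesis `hram` of part XXIV,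
universally; the Selmer cases are tree theorems of zhang3-p1 g9). CONDITIONAL on `hPT`, `hRam`; nothing is booked.
[cite: WZhang2014, §9 proof of Thm. 9.1, Lemma 8.2, Lemma 8.4] [cite: MilneADT2006, Ch. I, Thm. 4.10]
[cite: GrossLMS1991, Prop. 8.1–8.2, 9.6] -/
theorem stub_inductionOfLevelSystemsAtThree_of_poitouTate_of_ramifiedCase
    (hPT : ∀ (K : Type) [Field K] [NumberField K], IsImaginaryQuadratic K → poitouTate_selmerStructure_duality K)
    (hRam : ∀ (W : WeierstrassCurve ℚ) [W.IsElliptic] [W.IsGloballyMinimal] (K : Type) [Field K] [NumberField K],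
      IsImaginaryQuadratic K → W.HasSurjectiveModNGaloisRep 3 → ∀ (c : K ≃ₐ[ℚ] K), c ≠ 1 →
      ∀ (e : geomTorsion (W.baseChange K) ((3 ^ 1 : ℕ) : ℤ) → geomTorsion (W.baseChange K) ((3 ^ 1 : ℕ) : ℤ) →
          AlgebraicClosure K)
        (hμ : ∀ P Q, e P Q ^ (3 ^ 1) = 1) (hadd₁ : ∀ P₁ P₂ Q, e (P₁ + P₂) Q = e P₁ Q * e P₂ Q)
        (hadd₂ : ∀ P Q₁ Q₂, e P (Q₁ + Q₂) = e P Q₁ * e P Q₂) (_halt : ∀ Q, e Q Q = 1)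
        (_hnondeg : ∀ Q, (∀ P, e P Q = 1) → Q = 0)
        (hgal : ∀ (σ : absoluteGaloisGroup K) (P Q : geomTorsion (W.baseChange K) ((3 ^ 1 : ℕ) : ℤ)),
          σ • e P Q = e (σ • P) (σ • Q))
        {ℓ : ℕ} (hℓ : Zhang2014.IsKolyvaginPrime (W.conductorNorm ℤ) W K 3 ℓ) (v : HeightOneSpectrum (𝓞 K))
        (_hv : (ℓ : 𝓞 K) ∈ v.asIdeal) (s : Bool) (x y : V3 W K),
      conjAct W c ((3 ^ 1 : ℕ) : ℤ) x = sgn s • x → conjAct W c ((3 ^ 1 : ℕ) : ℤ) y = sgn s • y →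
      x ∉ selmerLocalKer (W.baseChange K) (v.adicCompletion K) ((3 ^ 1 : ℕ) : ℤ) →
      y ∉ selmerLocalKer (W.baseChange K) (v.adicCompletion K) ((3 ^ 1 : ℕ) : ℤ) →
      (weilContPairingLocal (W.baseChange K) (3 ^ 1) e hμ hadd₁ hadd₂ hgal (Sum.inr v)).cupProduct
        (galoisCohomology.localization ((W.baseChange K).torsionGaloisModule ((3 ^ 1 : ℕ) : ℤ)) (Sum.inr v) 1 x)
        (galoisCohomology.localization ((W.baseChange K).torsionGaloisModule ((3 ^ 1 : ℕ) : ℤ)) (Sum.inr v) 1 x) = 0 →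
      (weilContPairingLocal (W.baseChange K) (3 ^ 1) e hμ hadd₁ hadd₂ hgal (Sum.inr v)).cupProduct
        (galoisCohomology.localization ((W.baseChange K).torsionGaloisModule ((3 ^ 1 : ℕ) : ℤ)) (Sum.inr v) 1 x)
        (galoisCohomology.localization ((W.baseChange K).torsionGaloisModule ((3 ^ 1 : ℕ) : ℤ)) (Sum.inr v) 1 y) = 0 →
      (weilContPairingLocal (W.baseChange K) (3 ^ 1) e hμ hadd₁ hadd₂ hgal (Sum.inr v)).cupProduct
        (galoisCohomology.localization ((W.baseChange K).torsionGaloisModule ((3 ^ 1 : ℕ) : ℤ)) (Sum.inr v) 1 y)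
        (galoisCohomology.localization ((W.baseChange K).torsionGaloisModule ((3 ^ 1 : ℕ) : ℤ)) (Sum.inr v) 1 y) = 0 →
      x ∉ (W.baseChange K).torsionLocalKer (v.adicCompletion K) ((3 ^ 1 : ℕ) : ℤ) →
      ∃ a : ℤ, y - a • x ∈ (W.baseChange K).torsionLocalKer (v.adicCompletion K) ((3 ^ 1 : ℕ) : ℤ)) :
    ∀ (W : WeierstrassCurve ℚ) [W.IsElliptic] [W.IsGloballyMinimal] [NeZero (W.conductorNorm ℤ)] (K : Type)
      [Field K] [NumberField K] (Dt : ModularParametrizationData W (W.conductorNorm ℤ)) (β : ℤ) (ι : K →+* ℂ),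
      Summit.BirchSwinnertonDyer.Rank1Residual.ClassX11b W 3 → W.HasMultiplicativeReductionAtPrime 3 →
      Rank1Residual.Surj W 3 → Rank1Residual.Ram W 3 → ¬ 3 ∣ W.tamagawaProduct → IsImaginaryQuadratic K →
      Odd (NumberField.discr K) → SatisfiesHeegnerHypothesis (W.conductorNorm ℤ) K →
      (W.quadraticTwist (NumberField.discr K : ℚ)).entireLFunction 1 ≠ 0 → NumberField.discr K ≠ -3 →
      (4 * (W.conductorNorm ℤ : ℤ)) ∣ β ^ 2 - NumberField.discr K → ¬ (3 : ℤ) ∣ Dt.c →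
      ∀ (c : K ≃ₐ[ℚ] K), c ≠ 1 → ∀ [Module (ZMod 3) (V3 W K)],
      LevelKolyvaginSystem W K Dt β ι c →
      -- (A1) at the frame (stub A's body, verbatim) as HYPOTHESIS
      (∀ (n : Finset {q // IsUAdmissiblePrime W K q}) (μ : Bool) (x : V3 W K),
        GoodLevel W K n → x ∈ SelQ W K c n μ → x ≠ 0 →
        ∃ q : {q // IsUAdmissiblePrime W K q}, q ∉ n ∧ GoodLevel W K (insert q n) ∧
          x ∉ SelQ W K c (insert q n) μ ∧
          SelQ W K c (insert q n) μ ≤ SelQ W K c n μ ∧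
          finrank (ZMod 3) (SelQ W K c (insert q n) μ) + 1 = finrank (ZMod 3) (SelQ W K c n μ) ∧
          SelQ W K c (insert q n) (!μ) = SelQ W K c n (!μ)) →
      Odd (finrank (ZMod 3)
        (AddSubgroup.toZModSubmodule 3 (selmerGroup (W.baseChange K) ((3 ^ 1 : ℕ) : ℤ)))) →
      3 ≤ finrank (ZMod 3)
        (AddSubgroup.toZModSubmodule 3 (selmerGroup (W.baseChange K) ((3 ^ 1 : ℕ) : ℤ))) →
      ∃ (n : ℕ) (d : KolyvaginHeegnerData Dt β ι n),
        KolyvaginDescent.KolSupp (Zhang2014.IsKolyvaginPrime (W.conductorNorm ℤ) W K 3) n ∧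
          d.kolyvaginClass Nat.prime_three 1 ≠ 0 := by
  refine Method2EngineOfTriangulation.inductionOfLevelSystems_of_triangulation ?_
  intro W _ _ _ K _ _ Dt β ι hX hmult hsurj _hRam' _htam hK _hodd hH _hLt _h3 hβ _hc c hc1 _ S n hg hn _hev hne
  have hd : NumberField.discr K < -4 := discr_lt_neg_four_of_frame W K hX hK hH hβ
  obtain ⟨plK, hplK⟩ := exists_placesAbove_kolyvagin W K
  exact triangulation_of_poitouTate_of_ramifiedCase W K Dt β ι c hK hmult hsurj hd hc1 (hPT K hK) S plK hplK
    (fun e hμ hadd₁ hadd₂ halt hnondeg hgal ℓ s x y hxs hys hxK hyK h11 h12 h22 hx0 ↦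
      hRam W K hK hsurj c hc1 e hμ hadd₁ hadd₂ halt hnondeg hgal ℓ.2 (plK ℓ) (hplK ℓ) s x y hxs hys hxK hyK
        h11 h12 h22 hx0)
    n hg hn hne

end Summit.BirchSwinnertonDyer.Rank1Residual.X11b.Three.Koly.ZhangSupply

end
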